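import Literature.AlgebraicGeometry.Motives.AbelianVarietyFGSubfieldDescentEnd
import Literature.AlgebraicGeometry.Motives.AbelianVarietyBaseChangeFaithful
import Literature.AlgebraicGeometry.Motives.JacobianGaloisDescent
import Mathlib.NumberTheory.NumberField.Basic
import HarnessLib

/-!
# An abelian variety with a ring of endomorphisms over an algebraic extension of `ℚ` is defined over a
# number field (EGA IV₃ 8.8.2; Shimura 1998 §12.4 Prop. 26, «defined over an algebraic number field of
# finite degree»)

Topic `Literature/AlgebraicGeometry/Motives`; namespace `Literature.AlgebraicGeometry.Motives.AbelianVariety`.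
THEOREMS ONLY (no definition, no named fact, no instance).  Cell hodgecm-mathlib, row II-2, part (γ) of the cut
`(β) ℂ → ℚ̄`, `(γ) ℚ̄ → number field` of Shimura's Prop. 26 (director RULING 02:02:06Z): **`exists_numberField_descent_ringHom`**
— let `Ω` be a field algebraic over `ℚ` (e.g. `ℚ̄ ⊂ ℂ`), `A` an abelian variety over `Ω` and `ι : R → End_Ω(A)` a ring of
endomorphisms with `R` of finite type over `ℤ` (e.g. `R = 𝓞_K`).  Then there are a NUMBER FIELD `k ⊆ Ω`
(`k : IntermediateField ℚ Ω` with `NumberField k`), an abelian variety `A₁` over `k`, `ι₁ : R → End_k(A₁)` and an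
isomorphism of abelian varieties `e : A₁ ×_k Ω ≅ A` with `ι₁(a)_Ω ≫ e = e ≫ ι(a)` for all `a`.

## Proof

`R = ℤ[b₁, …, b_n]`; by `exists_finset_intermediateField_descent_end` (EGA IV₃ 8.8.2, file
`AbelianVarietyFGSubfieldDescentEnd`) the pair `(A, (ι bᵢ)ᵢ)` descends to every intermediate field containing a
finite set `S ⊆ Ω`; take `k = ℚ(S)`, finite over `ℚ` because `S` consists of algebraic elements (Mathlib
`IntermediateField.finiteDimensional_adjoin`).  The map `δ : End_k(A₁) → End_Ω(A)`, `f ↦ e⁻¹ ≫ f_Ω ≫ e`, is an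
INJECTIVE ring homomorphism (faithfulness of base change, `AbelianVariety.eq_of_baseChange_eq`, Görtz–Wedhorn I
Thm. 14.72 (1)) whose range contains the `ι bᵢ`, hence all of `ι(R)` (`Algebra.adjoin_induction`); so `ι` factors
uniquely through `δ`, which is `ι₁`.  Everything is proved; no named facts.

## References
* [EGAIV3] A. Grothendieck, J. Dieudonné, EGA IV₃ (1966), Thm. 8.8.2.
* [Shimura1998] G. Shimura, *Abelian Varieties with Complex Multiplication and Modular Functions* (1998), §12.4
  Prop. 26 (p. 109 of the corpus copy).
* [GortzWedhorn2020] U. Görtz, T. Wedhorn, *Algebraic Geometry I*, 2nd ed., Thm. 14.72 (1).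
-/

noncomputable section

open CategoryTheory CategoryTheory.Limits AlgebraicGeometry

universe v

namespace Literature.AlgebraicGeometry.Motives

namespace AbelianVariety

/-- **An abelian variety with a ring of endomorphisms of finite type, over a field algebraic over `ℚ`, is
defined over a number field**: for `Ω` algebraic over `ℚ`, `A / Ω` an abelian variety and `ι : R →+* End A`
with `R` of finite type over `ℤ`, there are a number field `k ⊆ Ω`, `A₁ / k`, `ι₁ : R →+* End A₁` and an
isomorphism `e : A₁ ×_k Ω ≅ A` of abelian varieties with `ι₁(a)_Ω ≫ e = e ≫ ι(a)` (the second half of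
Shimura's §12.4 Prop. 26, «defined over an algebraic number field of finite degree», via EGA IV₃ 8.8.2).
[cite: Shimura1998, §12.4 Prop. 26] [cite: EGAIV3, Thm. 8.8.2] [cite: GortzWedhorn2020, Thm. 14.72 (1)] -/
theorem exists_numberField_descent_ringHom (Ω : Type) [Field Ω] [CharZero Ω] [Algebra.IsAlgebraic ℚ Ω]
    (A : AbelianVariety Ω) {R : Type v} [Ring R] [Algebra.FiniteType ℤ R] (ι : R →+* End A) :
    ∃ (k : IntermediateField ℚ Ω) (_ : NumberField k) (A₁ : AbelianVariety k) (ι₁ : R →+* End A₁)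
      (e : A₁.baseChange Ω ≅ A), ∀ a : R, Hom.baseChange Ω (ι₁ a : A₁ ⟶ A₁) ≫ e.hom = e.hom ≫ (ι a : A ⟶ A) := by
  classical
  -- generators of `R` and the descent of `(A, (ι bᵢ)ᵢ)` to a finitely generated subfield
  obtain ⟨s, hs⟩ := Algebra.FiniteType.out (R := ℤ) (A := R)
  obtain ⟨S, hS⟩ := exists_finset_intermediateField_descent_end (F := ℚ) A (fun x : ↥s => (ι x : A ⟶ A))
  -- the number field `k = ℚ(S)`
  let k : IntermediateField ℚ Ω := IntermediateField.adjoin ℚ (S : Set Ω)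
  have hk : (↑S : Set Ω) ⊆ k := IntermediateField.subset_adjoin ℚ _
  haveI : FiniteDimensional ℚ k :=
    IntermediateField.finiteDimensional_adjoin fun x _ => (Algebra.IsAlgebraic.isAlgebraic x).isIntegral
  haveI hkN : NumberField k := NumberField.mk
  obtain ⟨A₁, e, r₁, hr₁⟩ := hS k hk
  -- `δ : End A₁ → End A`, `f ↦ e⁻¹ ≫ f_Ω ≫ e`, an injective ring homomorphism
  let δ : End A₁ →+* End A :=
    { toFun := fun f => e.inv ≫ Hom.baseChange Ω (f : A₁ ⟶ A₁) ≫ e.hom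
      map_one' := by
        change e.inv ≫ Hom.baseChange Ω (𝟙 A₁) ≫ e.hom = 𝟙 A
        rw [Hom.baseChange_id, Category.id_comp, Iso.inv_hom_id]
      map_mul' := fun f g => by
        change e.inv ≫ Hom.baseChange Ω ((g : A₁ ⟶ A₁) ≫ (f : A₁ ⟶ A₁)) ≫ e.hom =
          (e.inv ≫ Hom.baseChange Ω (g : A₁ ⟶ A₁) ≫ e.hom) ≫
            (e.inv ≫ Hom.baseChange Ω (f : A₁ ⟶ A₁) ≫ e.hom)
        rw [Hom.baseChange_comp]
        simp only [Category.assoc, Iso.hom_inv_id_assoc]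
      map_zero' := by
        change e.inv ≫ Hom.baseChange Ω (0 : A₁ ⟶ A₁) ≫ e.hom = (0 : A ⟶ A)
        rw [Hom.baseChange_zero, Limits.zero_comp, Limits.comp_zero]
      map_add' := fun f g => by
        -- additions read on `Hom`-types (`End X` is `X ⟶ X` only up to unfolding)
        change e.inv ≫ Hom.baseChange Ω (@HAdd.hAdd (A₁ ⟶ A₁) (A₁ ⟶ A₁) (A₁ ⟶ A₁) instHAdd f g) ≫ e.hom =
          @HAdd.hAdd (A ⟶ A) (A ⟶ A) (A ⟶ A) instHAdd (e.inv ≫ Hom.baseChange Ω (f : A₁ ⟶ A₁) ≫ e.hom)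
            (e.inv ≫ Hom.baseChange Ω (g : A₁ ⟶ A₁) ≫ e.hom)
        rw [Hom.baseChange_add, Preadditive.add_comp, Preadditive.comp_add] }
  have hδ : ∀ f : A₁ ⟶ A₁, @Eq (A ⟶ A) (δ f) (e.inv ≫ Hom.baseChange Ω f ≫ e.hom) := fun _ => rfl
  have hδinj : Function.Injective δ := by
    intro f g h
    change @Eq (A ⟶ A) (δ f) (δ g) at h
    rw [hδ, hδ] at h
    exact eq_of_baseChange_eq Ω A₁ A₁ ((cancel_mono e.hom).1 ((cancel_epi e.inv).1 h))
  -- the generators, hence all of `ι(R)`, lie in the range of `δ`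
  have hgen : ∀ x (hx : x ∈ s), ι x ∈ δ.range := fun x hx => ⟨r₁ ⟨x, hx⟩, by
    change @Eq (A ⟶ A) (δ (r₁ ⟨x, hx⟩)) (ι x)
    rw [hδ, Iso.inv_comp_eq]
    exact hr₁ ⟨x, hx⟩⟩
  have hall : ∀ a : R, ι a ∈ δ.range := by
    intro a
    have ha : a ∈ Algebra.adjoin ℤ (s : Set R) := by rw [hs]; trivial
    induction ha using Algebra.adjoin_induction with
    | mem y hy => exact hgen y hy
    | algebraMap n => rw [eq_intCast, map_intCast]; exact intCast_mem δ.range n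
    | add y z _ _ hy hz => rw [map_add]; exact add_mem hy hz
    | mul y z _ _ hy hz => rw [map_mul]; exact mul_mem hy hz
  -- `ι₁`: `ι` factored through the injective `δ`
  let E : End A₁ ≃+* δ.range :=
    RingEquiv.ofBijective δ.rangeRestrict
      ⟨fun a b h => hδinj (congrArg Subtype.val h), δ.rangeRestrict_surjective⟩
  let ι₁ : R →+* End A₁ := E.symm.toRingHom.comp (ι.codRestrict δ.range hall)
  have hι₁ : ∀ a, δ (ι₁ a) = ι a := fun a =>
    congrArg Subtype.val (E.apply_symm_apply (ι.codRestrict δ.range hall a))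
  refine ⟨k, hkN, A₁, ι₁, e, fun a => ?_⟩
  have h : @Eq (A ⟶ A) (δ (ι₁ a)) (ι a) := hι₁ a
  rw [hδ, Iso.inv_comp_eq] at h
  exact h

end AbelianVariety

end Literature.AlgebraicGeometry.Motives

end
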